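import Mathlib
import Summits.Ventures.PercRepro2.SwOutCrossBaseEdges

/-!
# The cross base: the structure vertices, crossing segments and their invariant — definitions and
the colour lemmas for `conn_mono` (blind cell PercRepro2, night-4 g23, 2026-08-28;
proofs/NIGHT4-G23.md §10, step (3), the red half)

Two points `x ≤ x'` of the cube in the restricted partition order — blue arms stay blue, red ports
(outside bits `false`) stay red ports, red links between red ports are kept — and `x` without
red-side leak. A red path of the realisation of `x` from a vertex `l` outside the structure to a
vertex `o` outside the structure, avoiding `h`, crosses the structure in segments: through one blue
arm (whose edges keep their colour at `x'`), or through the dropped vertices and `u` from a red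
port to a red port (a walk of the link graph, hence a red link kept at `x'`). So `o` is red-reached
from `l` at `x'` as well: `CrossBase.conn_mono`.
-/

namespace Summit.Ventures.PercRepro2

namespace CrossArm

open Hull LocRows

variable {V E : Type*}

open scoped Classical

section StrDefs

variable (h u : V) {ι X κ : Type*} (U : ι → Set V) (p : X → V) (F : κ → Set V)

/-- The structure vertices: `h`, `u`, the dropped vertices and the arms. -/
def strX : Set V := {v | v = h ∨ v = u ∨ (∃ i, v = p i) ∨ v ∈ armsAllX U F}

/-- A vertex outside the structure. -/
lemma notMem_strX_iff {v : V} :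
    v ∉ strX h u U p F ↔ v ≠ h ∧ v ≠ u ∧ (∀ i, v ≠ p i) ∧ v ∉ armsAllX U F := by
  simp only [strX, Set.mem_setOf_eq, not_or, not_exists, ne_eq]

end StrDefs

section Arms

variable {ι κ : Type*} {U : ι → Set V} {F : κ → Set V}

/-- An arm vertex lies in the arms. -/
lemma mem_armsAllX_of_U {j : ι} {v : V} (hv : v ∈ U j) : v ∈ armsAllX U F :=
  Or.inl (Set.mem_iUnion.2 ⟨j, hv⟩)

/-- A far-arm vertex lies in the arms. -/
lemma mem_armsAllX_of_F {k : κ} {v : V} (hv : v ∈ F k) : v ∈ armsAllX U F :=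
  Or.inr (Set.mem_iUnion.2 ⟨k, hv⟩)

/-- The arms are the u-arms and the far arms. -/
lemma mem_armsAllX_iff {v : V} : v ∈ armsAllX U F ↔ (∃ j, v ∈ U j) ∨ ∃ k, v ∈ F k := by
  simp only [armsAllX, Set.mem_union, Set.mem_iUnion]

end Arms

/-- A segment: a red path from `a` whose vertices after `a` lie in `S`. -/
def SegX (ends : E → Sym2 V) (ξ : Config E) (S : Set V) (a v : V) : Prop :=
  Relation.ReflTransGen (fun y z => (openGraph ends ξ).Adj y z ∧ z ∈ S) a v

/-- A segment is a red connection. -/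
lemma conn_of_segX {ends : E → Sym2 V} {ξ : Config E} {S : Set V} {a v : V}
    (h : SegX ends ξ S a v) : Conn ends ξ a v := by
  induction h with
  | refl => exact conn_refl _ _ _
  | tail _ hbc ih => exact conn_trans ih (SimpleGraph.Adj.reachable hbc.1)

section Inv

variable (ends : E → Sym2 V) (σ : Config E) (u : V) {ι X κ : Type*} (U : ι → Set V)
  (p : X → V) (G : SimpleGraph X) (F : κ → Set V)

/-- The invariant of a crossing segment from `a` (a vertex outside the structure) at the point
`x`, compared with `x'`: the vertex is `a`; or a vertex of a blue u-arm or far arm, red-reached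
from `a` at `x'`; or a link vertex (`u` or a dropped vertex) reached in the link graph of `x` from
a red port `p i` joined to `a`. -/
def CrossInv (x x' : PtXG ι κ X G) (a v : V) : Prop :=
  v = a ∨
    (∃ j, x.2.1 j = false ∧ v ∈ U j ∧ Conn ends (crossReal ends u U p G F σ x') a v) ∨
    (∃ k, x.1 k = false ∧ v ∈ F k ∧ Conn ends (crossReal ends u U p G F σ x') a v) ∨
    (∃ i, x.2.2.2.2 i = false ∧ (∃ e, ends e = s(a, p i)) ∧
      ∃ ov, v = linkVert u p ov ∧ (GlinkE G x.2.2).Reachable (some i) ov)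

end Inv

section Mono

variable {ends : E → Sym2 V} {σ : Config E} {h u : V} {ι X κ : Type*} {U : ι → Set V}
  {p : X → V} {G : SimpleGraph X} {F : κ → Set V} (hb : CrossBase ends σ h u U p G F)
include hb

/-- An edge with both ends outside the structure lies in no class: the realisation keeps `σ`. -/
lemma CrossBase.crossReal_apply_out {q : PtXG ι κ X G} {e : E} {y z : V} (he : ends e = s(y, z))
    (hy : y ∉ strX h u U p F) (hz : z ∉ strX h u U p F) :
    crossReal ends u U p G F σ q e = σ e := by
  rw [notMem_strX_iff] at hy hz
  apply CrossBase.crossReal_apply_none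
  · intro k hk
    rcases (mem_touches_iff_of_ends he).1 hk with hk | hk
    · exact hy.2.2.2 (mem_armsAllX_of_F hk)
    · exact hz.2.2.2 (mem_armsAllX_of_F hk)
  · intro j hj
    rcases (mem_touches_iff_of_ends he).1 hj with hj | hj
    · exact hy.2.2.2 (mem_armsAllX_of_U hj)
    · exact hz.2.2.2 (mem_armsAllX_of_U hj)
  · intro i hi
    have hi' : ends e = s(u, p i) := hi
    rw [he, Sym2.eq_iff] at hi'
    rcases hi' with ⟨rfl, -⟩ | ⟨-, rfl⟩
    · exact hy.2.1 rfl
    · exact hz.2.1 rfl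
  · rintro s ⟨i, j, -, hij⟩
    rw [he, Sym2.eq_iff] at hij
    rcases hij with ⟨rfl, -⟩ | ⟨rfl, -⟩
    · exact hy.2.2.1 i rfl
    · exact hy.2.2.1 j rfl
  · rintro i ⟨w, hw, -, -⟩
    rw [he, Sym2.eq_iff] at hw
    rcases hw with ⟨rfl, -⟩ | ⟨-, rfl⟩
    · exact hy.2.2.1 i rfl
    · exact hz.2.2.1 i rfl

/-- On an edge touching a u-arm blue at both points the two realisations agree. -/
lemma CrossBase.crossReal_eq_U {x x' : PtXG ι κ X G} {j : ι} (hj : x.2.1 j = false)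
    (hj' : x'.2.1 j = false) {e : E} (he : e ∈ touches ends (U j)) :
    crossReal ends u U p G F σ x' e = crossReal ends u U p G F σ x e := by
  rw [hb.crossReal_apply_U he, hb.crossReal_apply_U he, hj, hj']

/-- On an edge touching a far arm blue at both points the two realisations agree. -/
lemma CrossBase.crossReal_eq_F {x x' : PtXG ι κ X G} {k : κ} (hk : x.1 k = false)
    (hk' : x'.1 k = false) {e : E} (he : e ∈ touches ends (F k)) :
    crossReal ends u U p G F σ x' e = crossReal ends u U p G F σ x e := by
  rw [hb.crossReal_apply_F he, hb.crossReal_apply_F he, hk, hk']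

/-- A red u–`p i` edge of the realisation: the u-edge bit is red. -/
lemma CrossBase.uP_eq_true_of_red {x : PtXG ι κ X G} {i : X} {e : E} (he : ends e = s(u, p i))
    (hred : crossReal ends u U p G F σ x e = true) : x.2.2.1 i = true := by
  rw [hb.crossReal_apply_UP he, hb.u_red e (p i) he] at hred
  by_contra hc
  rw [if_neg hc] at hred
  exact absurd hred (by decide)

/-- A red outside edge of `p i` of the realisation: the outside bit is `false`. -/
lemma CrossBase.ext_eq_false_of_red {x : PtXG ι κ X G} {i : X} {e : E} {y : V}
    (he : ends e = s(p i, y)) (hyu : y ≠ u) (hyp : ∀ j, y ≠ p j)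
    (hred : crossReal ends u U p G F σ x e = true) : x.2.2.2.2 i = false := by
  rw [hb.crossReal_apply_Ext ⟨y, he, hyu, hyp⟩, hb.ext_blue i e y he hyu hyp] at hred
  by_contra hc
  rw [Bool.not_eq_false] at hc
  rw [if_pos hc] at hred
  exact absurd hred (by decide)

/-- An outside edge of `p i` is red at a point with outside bit `false`. -/
lemma CrossBase.ext_red_of_eq_false {x : PtXG ι κ X G} {i : X} {e : E} {y : V}
    (he : ends e = s(p i, y)) (hyu : y ≠ u) (hyp : ∀ j, y ≠ p j) (hi : x.2.2.2.2 i = false) :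
    crossReal ends u U p G F σ x e = true := by
  rw [hb.crossReal_apply_Ext ⟨y, he, hyu, hyp⟩, hb.ext_blue i e y he hyu hyp, hi]
  rfl

/-- A red boundary edge of a u-arm: the arm is blue. -/
lemma CrossBase.arm_eq_false_of_red {x : PtXG ι κ X G} {j : ι} {e : E} {y a : V}
    (he : ends e = s(y, a)) (hy : y ∈ U j) (ha : a ∉ strX h u U p F)
    (hred : crossReal ends u U p G F σ x e = true) : x.2.1 j = false := by
  rw [notMem_strX_iff] at ha
  rw [hb.crossReal_apply_U ⟨y, hy, a, he⟩,
    hb.bdry_blue e y a he (mem_armsAllX_of_U hy) ha.1 ha.2.1 ha.2.2.1 ha.2.2.2] at hred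
  by_contra hc
  rw [Bool.not_eq_false] at hc
  rw [if_pos hc] at hred
  exact absurd hred (by decide)

/-- A red boundary edge of a far arm: the arm is blue. -/
lemma CrossBase.far_eq_false_of_red {x : PtXG ι κ X G} {k : κ} {e : E} {y a : V}
    (he : ends e = s(y, a)) (hy : y ∈ F k) (ha : a ∉ strX h u U p F)
    (hred : crossReal ends u U p G F σ x e = true) : x.1 k = false := by
  rw [notMem_strX_iff] at ha
  rw [hb.crossReal_apply_F ⟨y, hy, a, he⟩,
    hb.bdry_blue e y a he (mem_armsAllX_of_F hy) ha.1 ha.2.1 ha.2.2.1 ha.2.2.2] at hred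
  by_contra hc
  rw [Bool.not_eq_false] at hc
  rw [if_pos hc] at hred
  exact absurd hred (by decide)

/-- A σ-red edge touching a blue u-arm is blue in the realisation. -/
lemma CrossBase.not_red_U_of_sigma_red {x : PtXG ι κ X G} {j : ι} {e : E}
    (he : e ∈ touches ends (U j)) (hj : x.2.1 j = false) (hσ : σ e = true) :
    crossReal ends u U p G F σ x e = false := by
  rw [hb.crossReal_apply_U he, hj, hσ]
  rfl

/-- A σ-red edge touching a blue far arm is blue in the realisation. -/
lemma CrossBase.not_red_F_of_sigma_red {x : PtXG ι κ X G} {k : κ} {e : E}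
    (he : e ∈ touches ends (F k)) (hk : x.1 k = false) (hσ : σ e = true) :
    crossReal ends u U p G F σ x e = false := by
  rw [hb.crossReal_apply_F he, hk, hσ]
  rfl

end Mono

end CrossArm

end Summit.Ventures.PercRepro2
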